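import Literature.Analysis.FluidPDE.PlanarAngularDerivative
import Literature.Analysis.FluidPDE.BurgersVortexSteady
import HarnessLib

/-!
# Bounds for the Gaussian-vortex kernel weight `Φ = G/(2Ω)` and its gradient on the plane

Analysis/FluidPDE file (all results proved, no definitions, no named facts). For the profile
function `φ(t) = (1 − e^{−t})/t` (`burgersPhi`) and the kernel weight
`Φ(r) = e^{−r²/4}/φ(r²/4) = (r²/4)/(e^{r²/4} − 1)` (`kerWeight`, `GaussianVortexKernelRadial`;
`Φ = G/(2Ω)` relates the Gaussian vorticity `G` and the angular velocity `Ω` of the vortex,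
Maekawa 2009, §2.2–§3: the weight of `Λ_a⁻¹Λ_b`), we prove the elementary estimates used to
control the correction `Φψ` of Maekawa's skew-symmetrizer (`PlanarAngularDerivative`):

* `one_div_one_add_le_burgersPhi` — `φ(t) ≥ 1/(1+t)` for `t ≥ 0` (`1 + t ≤ eᵗ`);
* `abs_deriv_burgersPhi_le_one`, `exists_abs_deriv_burgersPhi_le` — `|φ'| ≤ 1` on `[1, ∞)` and
  `|φ'| ≤ M` on `[0, ∞)` (from `tφ'(t) = e^{−t} − φ(t)`, the tree's
  `StrainedAzimuthal.mul_deriv_burgersPhi`, and continuity on `[0,1]`);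
* `kerWeight_sq_le` — `Φ(r)² ≤ (1 + r²/4)² e^{−r²/2}` (Gaussian decay, not just `e^{−r²/8}`);
* `contDiff_kerWeight_norm`, `exists_norm_fderiv_kerWeight_norm_le` — `x ↦ Φ(|x|)` is `C¹` on
  `ℝ²` with `|∇(Φ∘|·|)(x)| ≤ C (1 + |x|²)² |x| e^{−|x|²/4}`.

## References

* Y. Maekawa, *Existence of asymmetric Burgers vortices and their asymptotic behavior at large
  circulations*, Math. Models Methods Appl. Sci. 19 (2009), §3 (Prop. 3.1: "`ϕ` is positive and
  strictly decreasing with the order `r⁻²`, and bounded"). [Maekawa2009b]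
* Th. Gallay, C. E. Wayne, J. Math. Fluid Mech. 9 (2007), proof of Prop. 3.1 (the weight `h`).
  [GallayWayne2006]
-/

open MeasureTheory Filter Set Metric Function
open scoped Real Topology

noncomputable section

namespace Literature.Analysis.FluidPDE

/-! ### The profile function: lower bound and derivative -/

/-- **`φ(t) ≥ 1/(1+t)` for `t ≥ 0`** (equivalent to `(1+t)e^{−t} ≤ 1`). Private copy of the same
statement in a Summits Theorems file (`MarginalStabilityChainStretchedVortexRows…`), which a
Literature file cannot import. [folklore] -/
private theorem one_div_one_add_le_burgersPhi {t : ℝ} (ht : 0 ≤ t) : 1 / (1 + t) ≤ burgersPhi t := by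
  rcases ht.eq_or_lt with rfl | ht'
  · simp
  · rw [burgersPhi_of_ne_zero ht'.ne', div_le_div_iff₀ (by linarith) ht']
    have h1 : 1 + t ≤ Real.exp t := by linarith [Real.add_one_le_exp t]
    have h2 : Real.exp (-t) * Real.exp t = 1 := by rw [← Real.exp_add]; simp
    nlinarith [Real.exp_pos (-t), Real.exp_pos t]

/-- `φ(t)⁻¹ ≤ 1 + t` for `t ≥ 0` (private copy, same reason). [folklore] -/
private theorem inv_burgersPhi_le {t : ℝ} (ht : 0 ≤ t) : (burgersPhi t)⁻¹ ≤ 1 + t := by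
  have h := one_div_one_add_le_burgersPhi ht
  rw [div_le_iff₀ (by linarith)] at h
  rw [inv_le_iff_one_le_mul₀ (burgersPhi_pos t)]
  linarith [mul_comm (burgersPhi t) (1 + t)]

/-- `|φ'(t)| ≤ 1` for `t ≥ 1` (`φ' = (e^{−t} − φ)/t`, both terms in `[0,1]`). [folklore] -/
theorem abs_deriv_burgersPhi_le_one {t : ℝ} (ht : 1 ≤ t) : |deriv burgersPhi t| ≤ 1 := by
  have h := StrainedAzimuthal.mul_deriv_burgersPhi t
  have hφ0 := (burgersPhi_pos t).le
  have hφ1 := burgersPhi_le_one (show (0 : ℝ) ≤ t by linarith)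
  have he0 := (Real.exp_pos (-t)).le
  have he1 : Real.exp (-t) ≤ 1 := Real.exp_le_one_iff.2 (by linarith)
  have ht0 : 0 < t := by linarith
  have hd : deriv burgersPhi t = (Real.exp (-t) - burgersPhi t) / t := by
    field_simp; linarith
  rw [hd, abs_div, abs_of_pos ht0, div_le_one ht0, abs_le]
  constructor <;> linarith

/-- **`φ'` is bounded on `[0, ∞)`**: `|φ'(t)| ≤ M` (continuity on `[0,1]`, the previous bound on
`[1,∞)`). [folklore] -/
theorem exists_abs_deriv_burgersPhi_le : ∃ M : ℝ, 0 ≤ M ∧ ∀ t, 0 ≤ t → |deriv burgersPhi t| ≤ M := by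
  have hc : Continuous (deriv burgersPhi) := (contDiff_burgersPhi (n := 1)).continuous_deriv le_rfl
  obtain ⟨M₀, hM₀⟩ := isCompact_Icc.exists_bound_of_continuousOn (s := Icc (0 : ℝ) 1) hc.continuousOn
  refine ⟨max M₀ 1, le_max_of_le_right zero_le_one, fun t ht => ?_⟩
  rcases le_or_gt t 1 with h1 | h1
  · exact ((Real.norm_eq_abs _).symm.le.trans (hM₀ t ⟨ht, h1⟩)).trans (le_max_left _ _)
  · exact (abs_deriv_burgersPhi_le_one h1.le).trans (le_max_right _ _)

/-! ### The kernel weight: Gaussian decay -/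

/-- **`Φ(r) ≤ (1 + r²/4) e^{−r²/4}`** (`s/(eˢ − 1) ≤ (1+s)e^{−s}` iff `1 + s ≤ eˢ`). Private copy of
the same statement in a Summits Theorems file (`…OddArnoldToolsA.arnold_kerWeight_le`), which a
Literature file cannot import; the public form is `kerWeight_sq_le`. [folklore] -/
private theorem kerWeight_le_mul_exp (r : ℝ) :
    kerWeight r ≤ (1 + r ^ 2 / 4) * Real.exp (-(r ^ 2 / 4)) := by
  rcases eq_or_ne r 0 with rfl | hr
  · simp
  · rw [kerWeight_eq hr]
    set s := r ^ 2 / 4 with hs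
    have hs0 : 0 < s := by positivity
    have hden : 0 < Real.exp s - 1 := by
      have : 1 < Real.exp s := Real.one_lt_exp_iff.2 hs0; linarith
    rw [div_le_iff₀ hden]
    have h1 : 1 + s ≤ Real.exp s := by linarith [Real.add_one_le_exp s]
    have h2 : Real.exp (-s) * Real.exp s = 1 := by rw [← Real.exp_add]; simp
    nlinarith [Real.exp_pos (-s), Real.exp_pos s]

/-- `Φ(r)² ≤ (1 + r²/4)² e^{−r²/2}`. [folklore] -/
theorem kerWeight_sq_le (r : ℝ) :
    kerWeight r ^ 2 ≤ (1 + r ^ 2 / 4) ^ 2 * Real.exp (-(r ^ 2 / 2)) := by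
  have h := kerWeight_le_mul_exp r
  have h0 := (kerWeight_pos r).le
  have he : Real.exp (-(r ^ 2 / 4)) ^ 2 = Real.exp (-(r ^ 2 / 2)) := by
    rw [← Real.exp_nat_mul]; ring_nf
  calc kerWeight r ^ 2 ≤ ((1 + r ^ 2 / 4) * Real.exp (-(r ^ 2 / 4))) ^ 2 :=
        pow_le_pow_left₀ h0 h 2
    _ = (1 + r ^ 2 / 4) ^ 2 * Real.exp (-(r ^ 2 / 2)) := by rw [mul_pow, he]

/-! ### The kernel weight on the plane: `C¹` with a Gaussian gradient bound -/

/-- The auxiliary profile `K(s) = e^{−s/4}/φ(s/4)` (so `Φ(|x|) = K(|x|²)`) is `C¹`. [folklore] -/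
theorem contDiff_kerWeightAux :
    ContDiff ℝ 1 fun s : ℝ => Real.exp (-(s / 4)) / burgersPhi (s / 4) :=
  (Real.contDiff_exp.comp (contDiff_id.div_const 4).neg).div
    (contDiff_burgersPhi.comp (contDiff_id.div_const 4)) fun _ => (burgersPhi_pos _).ne'

/-- **`x ↦ Φ(|x|)` is `C¹` on `ℝ²`.** [folklore] -/
theorem contDiff_kerWeight_norm :
    ContDiff ℝ 1 fun y : EuclideanSpace ℝ (Fin 2) => kerWeight ‖y‖ := by
  simp_rw [kerWeight_norm_eq_comp_normSq]
  exact contDiff_kerWeightAux.comp (contDiff_norm_sq ℝ)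

/-- The derivative of `K`: `K'(s) = −¼ e^{−s/4} (1/φ(s/4) + φ'(s/4)/φ(s/4)²)`. [folklore] -/
theorem hasDerivAt_kerWeightAux (s : ℝ) :
    HasDerivAt (fun s : ℝ => Real.exp (-(s / 4)) / burgersPhi (s / 4))
      (-(1 / 4) * Real.exp (-(s / 4)) * ((burgersPhi (s / 4))⁻¹ +
        deriv burgersPhi (s / 4) / burgersPhi (s / 4) ^ 2)) s := by
  have hd : Differentiable ℝ burgersPhi := (contDiff_burgersPhi (n := 1)).differentiable one_ne_zero
  have h1 : HasDerivAt (fun s : ℝ => Real.exp (-(s / 4))) (Real.exp (-(s / 4)) * (-(1 / 4))) s :=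
    ((hasDerivAt_id' s).div_const 4).neg.exp
  have h2 : HasDerivAt (fun s : ℝ => burgersPhi (s / 4)) (deriv burgersPhi (s / 4) * (1 / 4)) s :=
    (hd (s / 4)).hasDerivAt.comp s ((hasDerivAt_id' s).div_const 4)
  have hφ : burgersPhi (s / 4) ≠ 0 := (burgersPhi_pos _).ne'
  refine (h1.div h2 hφ).congr_deriv ?_
  field_simp
  ring

/-- The Gaussian bound on `K'`: `|K'(s)| ≤ ¼ (1 + M)(1 + s/4)² e^{−s/4}` for `s ≥ 0`, `M` a bound
for `|φ'|` on `[0,∞)`. [folklore] -/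
theorem abs_deriv_kerWeightAux_le {M : ℝ} (hM0 : 0 ≤ M)
    (hM : ∀ t, 0 ≤ t → |deriv burgersPhi t| ≤ M) {s : ℝ} (hs : 0 ≤ s) :
    |deriv (fun s : ℝ => Real.exp (-(s / 4)) / burgersPhi (s / 4)) s| ≤
      (1 / 4) * (1 + M) * (1 + s / 4) ^ 2 * Real.exp (-(s / 4)) := by
  rw [(hasDerivAt_kerWeightAux s).deriv]
  have hs4 : 0 ≤ s / 4 := by positivity
  have hφpos := burgersPhi_pos (s / 4)
  have hinv := inv_burgersPhi_le hs4
  have hinv0 : 0 ≤ (burgersPhi (s / 4))⁻¹ := inv_nonneg.2 hφpos.le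
  have hd := hM (s / 4) hs4
  have he := (Real.exp_pos (-(s / 4))).le
  -- `|1/φ + φ'/φ²| ≤ (1+s/4) + M(1+s/4)² ≤ (1+M)(1+s/4)²`
  have hsq : (burgersPhi (s / 4))⁻¹ ^ 2 ≤ (1 + s / 4) ^ 2 := pow_le_pow_left₀ hinv0 hinv 2
  have hterm : |(burgersPhi (s / 4))⁻¹ + deriv burgersPhi (s / 4) / burgersPhi (s / 4) ^ 2| ≤
      (1 + M) * (1 + s / 4) ^ 2 := by
    have h1 : |deriv burgersPhi (s / 4) / burgersPhi (s / 4) ^ 2| ≤ M * (1 + s / 4) ^ 2 := by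
      rw [abs_div, abs_of_pos (pow_pos hφpos 2), div_eq_mul_inv, ← inv_pow]
      exact mul_le_mul hd hsq (by positivity) hM0
    have h2 : |(burgersPhi (s / 4))⁻¹| ≤ 1 * (1 + s / 4) ^ 2 := by
      rw [abs_of_nonneg hinv0, one_mul]
      nlinarith
    calc |(burgersPhi (s / 4))⁻¹ + deriv burgersPhi (s / 4) / burgersPhi (s / 4) ^ 2|
        ≤ |(burgersPhi (s / 4))⁻¹| + |deriv burgersPhi (s / 4) / burgersPhi (s / 4) ^ 2| :=
          abs_add_le _ _
      _ ≤ 1 * (1 + s / 4) ^ 2 + M * (1 + s / 4) ^ 2 := add_le_add h2 h1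
      _ = (1 + M) * (1 + s / 4) ^ 2 := by ring
  rw [abs_mul, abs_mul, abs_of_nonneg he, show |(-(1 / 4) : ℝ)| = 1 / 4 by norm_num]
  calc 1 / 4 * Real.exp (-(s / 4)) *
      |(burgersPhi (s / 4))⁻¹ + deriv burgersPhi (s / 4) / burgersPhi (s / 4) ^ 2|
      ≤ 1 / 4 * Real.exp (-(s / 4)) * ((1 + M) * (1 + s / 4) ^ 2) :=
        mul_le_mul_of_nonneg_left hterm (by positivity)
    _ = (1 / 4) * (1 + M) * (1 + s / 4) ^ 2 * Real.exp (-(s / 4)) := by ring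

/-- **Gaussian gradient bound for `Φ(|x|)` on the plane**: there is `C ≥ 0` with
`‖D(Φ∘|·|)(x)‖ ≤ C (1 + |x|²/4)² |x| e^{−|x|²/4}` for all `x ∈ ℝ²` (chain rule through `|x|²`,
`∇(K(|x|²)) = 2K'(|x|²) x`). [folklore] -/
theorem exists_norm_fderiv_kerWeight_norm_le : ∃ C : ℝ, 0 ≤ C ∧ ∀ x : EuclideanSpace ℝ (Fin 2),
    ‖fderiv ℝ (fun y : EuclideanSpace ℝ (Fin 2) => kerWeight ‖y‖) x‖ ≤
      C * (1 + ‖x‖ ^ 2 / 4) ^ 2 * ‖x‖ * Real.exp (-(‖x‖ ^ 2 / 4)) := by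
  obtain ⟨M, hM0, hM⟩ := exists_abs_deriv_burgersPhi_le
  refine ⟨2 * ((1 / 4) * (1 + M)), by positivity, fun x => ?_⟩
  set K : ℝ → ℝ := fun s => Real.exp (-(s / 4)) / burgersPhi (s / 4) with hK
  have hKd : HasDerivAt K (deriv K (‖x‖ ^ 2)) (‖x‖ ^ 2) :=
    (hasDerivAt_kerWeightAux (‖x‖ ^ 2)).differentiableAt.hasDerivAt
  have hn : HasFDerivAt (fun y : EuclideanSpace ℝ (Fin 2) => ‖y‖ ^ 2) ((2 : ℝ) • innerSL ℝ x) x := by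
    have h := (hasStrictFDerivAt_norm_sq x).hasFDerivAt
    refine h.congr_fderiv ?_
    ext v; simp [two_smul]
  have hcomp := hKd.hasFDerivAt.comp x hn
  have hfun : (fun y : EuclideanSpace ℝ (Fin 2) => kerWeight ‖y‖) =
      K ∘ fun y : EuclideanSpace ℝ (Fin 2) => ‖y‖ ^ 2 :=
    funext fun y => kerWeight_norm_eq_comp_normSq y
  rw [hfun, hcomp.fderiv]
  have hop : ‖(ContinuousLinearMap.toSpanSingleton ℝ (deriv K (‖x‖ ^ 2))).comp
      ((2 : ℝ) • innerSL ℝ x)‖ ≤ |deriv K (‖x‖ ^ 2)| * (2 * ‖x‖) := by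
    refine (ContinuousLinearMap.opNorm_comp_le _ _).trans ?_
    rw [ContinuousLinearMap.norm_toSpanSingleton, norm_smul, innerSL_apply_norm, Real.norm_eq_abs,
      Real.norm_eq_abs, abs_two]
  have hb := abs_deriv_kerWeightAux_le hM0 hM (sq_nonneg ‖x‖)
  calc ‖(ContinuousLinearMap.toSpanSingleton ℝ (deriv K (‖x‖ ^ 2))).comp ((2 : ℝ) • innerSL ℝ x)‖
      ≤ |deriv K (‖x‖ ^ 2)| * (2 * ‖x‖) := hop
    _ ≤ (1 / 4) * (1 + M) * (1 + ‖x‖ ^ 2 / 4) ^ 2 * Real.exp (-(‖x‖ ^ 2 / 4)) * (2 * ‖x‖) :=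
        mul_le_mul_of_nonneg_right hb (by positivity)
    _ = 2 * ((1 / 4) * (1 + M)) * (1 + ‖x‖ ^ 2 / 4) ^ 2 * ‖x‖ * Real.exp (-(‖x‖ ^ 2 / 4)) := by
        ring

end Literature.Analysis.FluidPDE
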